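import Summits.BirchSwinnertonDyer.BirchSwinnertonDyer.Theorems.EisensteinPrimesMazurMCOnCellBTwistbackTwoStepChain
import HarnessLib

/-!
# Crux 3 `MazurMCOnCellB` (stmt-BirchSwinnertonDyer-19033), line `twistback` v7 — ROAD (e) ALONG CHAINS, BY NAME:
# PER PAIR the stub's (∃-PARTNER) clause ⟹ Mazur's main conjecture, and the crux BY NAME from the named facts +
# «(∃-PARTNER) at every X2b pair with NO Ш-unit end reachable at distance ≥ 0» (reachability tested BEFORE the partner road)

Width seat bsd-line-x2-p1-w6 (gen 3), cell `bsd-eis`, 2026-08-28; `--supports stmt-BirchSwinnertonDyer-19033 --as helper`;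
third file of the seat after `…TwistbackTwoStepDefs` (p667979: the edge `TwoStepAt p`) and `…TwistbackTwoStepChain`
(p668570: transfers along `Relation.ReflTransGen` / `TransGen` chains). HONEST FRAMING: conditional theorems only; no
`def`, no named fact introduced, no `sorry`; closes no registered stub; the crux is concluded BY NAME only under the named
facts AND the hypothesis `hoff` (audit `proof.conditional`, credits nothing — as LEAD g13's `…OfNamedFactsV7`, p665922);
no summit statement, no Mazur main conjecture and no BSD is proved for any curve; 0 cells / labels / stubs / tiers move.

## What and why

The registered composition `MazurMCOnCellB_of` (twistback v4–v7) feeds the CLASS-WIDE door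
`…TwistbackOnePartner.mazurMCOnCellB_of_kRankOne_of_exists_upper_partner` (p640326) with the (∃-PARTNER) clause at
EVERY X2b pair (`upperPartner_all`), so even a pair `(W, p)` with `p ∤ #Ш_an(W)` — where Wuthrich 2014 Prop. 21 already
gives the main conjecture (`X2.mazurMainConjectureAt_of_cellB_of_shaAn_unit`) — is asked for a partner. LEAD g14's plan
(STATUS 20:54:01Z, item (2)) is to take the distance-zero unit ends OUT of the stub's honest hypothesis set. That needs the
composition to decide PER PAIR which road it takes. This file supplies the two pieces:

* `mazurMainConjectureAt_of_cellB_of_upperPartnerClause` (+ `bsdp_…`): PER PAIR, `X2.CellB W p` + the stub's (∃-PARTNER)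
  clause at `(W, p)` ⟹ `X2.MazurMainConjectureAt W p` — pick ONE globally minimal model of `E^{(d_K)}` (Néron;
  `exists_isGloballyMinimal_smul_eq_quadraticTwist`) and run x2-p1-w6 g2's per-pair core
  `…TwistbackOnePartnerAt.mazurMainConjectureAt_of_cellB_of_upper_partnerAt` (p663790 §1).
* `mazurMCOnCellB_of_namedFacts_of_upperPartnerOffReachableUnitEnd`: `EisensteinPrimes.MazurMCOnCellB` BY NAME from the
  v7 cone's named facts + Wuthrich Prop. 21 and
  `hoff : ∀ X2b (W, p), ¬ (∃ W″, Relation.ReflTransGen (TwoStepAt p) W W″ ∧ #Ш_an(W″) a rational p-unit) → (∃-PARTNER)`: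
  per pair, excluded middle on reachability at distance `≥ 0` — reachable ⟹
  `…TwoStepChain.mazurMainConjectureAt_of_cellB_of_exists_reflTransGen_shaAn_unit` (distance `0` = Prop. 21 at the pair,
  distance `≥ 1` = road (e) along the chain), else the clause and the per-pair door. A v8 whose stub 6‴ is `hoff`'s
  antecedent shape (plus the closed sub-row exclusion, derived as in v5–v7) would make THIS the composition term.

HYPOTHESES BY NAME (nothing asserted): `PublishedInputs` (stmt-…-19037), Poitou–Tate ×2 (tree THEOREMS, fed by the
skeleton's `poitouTate_pair`), Hsieh 2014 Thm. 1, Liu–Zhang–Zhang 2018, Mazur 1978 Cor. 4.1 (PUBLISHED / refereed),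
Keller–Yin 2024 Thm. D (PRE), Wuthrich 2014 Prop. 21 (PUBLISHED). References: [KellerYin2024] Thm. D (PRE); [Wuthrich2014]
Thm. 16, Prop. 21; [SilvermanAEC2009] VIII.8 Cor. 8.3; [JetchevSkinnerWan2017] §7.4.1; [Mazur1978] Cor. 4.1; [Darmon2004]
Thm. 3.6; [Miller2011LMS] Def. 1.1.
-/

set_option autoImplicit false
-- `Summit.BirchSwinnertonDyer.BirchSwinnertonDyer.…`: the summit and its single sub-problem share a name.
set_option linter.dupNamespace false

noncomputable section

open scoped Classical MatrixGroups ModularForm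

open CongruenceSubgroup WeierstrassCurve NumberField
  Literature.NumberTheory.EllipticCurves
  Literature.NumberTheory.EllipticCurves.ModularForms
  Literature.NumberTheory.QuadraticFields
  Literature.NumberTheory.EllipticCurves.Rank1Residual
  Literature.NumberTheory.EllipticCurves.Rank1Residual.Typed
  Literature.NumberTheory.EllipticCurves.Wuthrich2014
  Literature.NumberTheory.EllipticCurves.SteinWuthrich2013
  Literature.NumberTheory.EllipticCurves.GreenbergVatsal2000
  Literature.NumberTheory.EllipticCurves.KellerYin2024
  Literature.NumberTheory.GaloisCohomology
  Summit.BirchSwinnertonDyer.Rank1Residual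
  Summit.BirchSwinnertonDyer.BirchSwinnertonDyer.Theses
  Summit.BirchSwinnertonDyer.BirchSwinnertonDyer.Theorems.EisensteinPrimesMazurMCOnCellBTwistbackTwoStepDefs
  Summit.BirchSwinnertonDyer.BirchSwinnertonDyer.Theorems.EisensteinPrimesMazurMCOnCellBTwistbackOnePartnerAt
  Summit.BirchSwinnertonDyer.BirchSwinnertonDyer.Theorems.EisensteinPrimesMazurMCOnCellBTwistbackTwoStepChain

namespace Summit.BirchSwinnertonDyer.BirchSwinnertonDyer.Theorems.EisensteinPrimesMazurMCOnCellBTwistbackTwoStepChainByName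

/-! ## PER PAIR: the (∃-PARTNER) clause ⟹ the main conjecture; the crux BY NAME from
«reachable unit end at distance ≥ 0» ∨ «(∃-PARTNER) off the reachable unit ends» — the shape of a composition that tests
reachability BEFORE the partner road -/

/-- **PER PAIR: the stub's (∃-PARTNER) clause at `(W, p)` gives Mazur's main conjecture at `(W, p)`.** From the clause
(an admissible `K` with `ord_{s=1} L(E^{(d_K)},s) = 1` and the upper half at EVERY globally minimal model of `E^{(d_K)}`)
pick ONE globally minimal model `Wd` of the twist (Néron / Silverman AEC VIII.8 Cor. 8.3:
`exists_isGloballyMinimal_smul_eq_quadraticTwist`) and run x2-p1-w6 g2's per-pair core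
`…TwistbackOnePartnerAt.mazurMainConjectureAt_of_cellB_of_upper_partnerAt` (optimal curve, Heegner datum and point, STEP L
from item -27489 ⟸ Keller–Yin Thm. D, per-pair lower half, Cassels, exact converse). The class-wide composition
`…TwistbackOnePartner.mazurMCOnCellB_of_kRankOne_of_exists_upper_partner` (p640326) needs the clause at EVERY X2b pair;
this per-pair form lets a skeleton mix roads pair by pair. CONDITIONAL on the named facts; a main conjecture is proved
for no curve. [claim: KellerYin2024, status: under-review] [cite: KellerYin2024, Thm. D = Thm. 5.1.3 (arXiv:2402.12781v2 L306–L309)]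
[cite: SilvermanAEC2009, VIII.8 Cor. 8.3] [cite: JetchevSkinnerWan2017, §7.4.1] [cite: Mazur1978, Cor. 4.1]
[cite: Darmon2004, Thm. 3.6] [cite: Wuthrich2014, Thm. 16 (p. 397)] -/
theorem mazurMainConjectureAt_of_cellB_of_upperPartnerClause (hP : EisensteinPrimes.PublishedInputs)
    (hPT : ∀ (K : Type) [Field K] [NumberField K], poitouTate_selmerStructure_duality K)
    (hPT2 : ∀ (K : Type) [Field K] [NumberField K], poitouTate_sha_tateDual K)
    (hH : hsieh2014_exists_anticyclotomicPAdicLFunction)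
    (hF : LiuZhangZhang2018.thm151_thm153_modularCurve_heegnerVector) (hMaz : mazur_not_dvd_maninConstant_of_odd)
    (hD : KellerYin2024.thmD_imcMult_exists_isBDPLFunction_isTorsion_charIdeal_eq_OPEN)
    (W : WeierstrassCurve ℚ) [W.IsElliptic] [W.IsGloballyMinimal] (p : ℕ) [Fact p.Prime] (hc : X2.CellB W p)
    (hK : ∃ (K : Type) (_ : Field K) (_ : NumberField K), IsImaginaryQuadratic K ∧
      SatisfiesHeegnerHypothesis (W.conductorNorm ℤ) K ∧ SatisfiesHeegnerHypothesis p K ∧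
      Odd (NumberField.discr K) ∧ NumberField.discr K < -4 ∧
      (W.quadraticTwist (NumberField.discr K : ℚ)).analyticRank = 1 ∧
      ∀ (Wd : WeierstrassCurve ℚ) [Wd.IsElliptic] [Wd.IsGloballyMinimal],
        (∃ C : VariableChange ℚ, C • Wd = W.quadraticTwist (NumberField.discr K : ℚ)) →
        MissingUpperBoundAt Wd p) :
    X2.MazurMainConjectureAt W p := by
  obtain ⟨K, _, _, hK, hHN, hHp, hodd, hlt, hr1, hall⟩ := hK
  have hd0 : (NumberField.discr K : ℚ) ≠ 0 := by exact_mod_cast (IsImaginaryQuadratic.discr_neg hK).ne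
  obtain ⟨Wd, _, _, C, hC⟩ := exists_isGloballyMinimal_smul_eq_quadraticTwist W hd0
  exact mazurMainConjectureAt_of_cellB_of_upper_partnerAt hP hPT hPT2 hH hF hMaz hD W p hc K hK hHN hHp hodd hlt hr1
    Wd ⟨C, hC⟩ (hall Wd ⟨C, hC⟩)

/-- **PER PAIR, `BSD(E,p)` form** of `mazurMainConjectureAt_of_cellB_of_upperPartnerClause`
(`…TwistbackOnePartnerAt.bsdp_of_cellB_of_upper_partnerAt`). CONDITIONAL on the named facts.
[claim: KellerYin2024, status: under-review] [cite: SilvermanAEC2009, VIII.8 Cor. 8.3] [cite: Miller2011LMS, Def. 1.1] -/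
theorem bsdp_of_cellB_of_upperPartnerClause (hP : EisensteinPrimes.PublishedInputs)
    (hPT : ∀ (K : Type) [Field K] [NumberField K], poitouTate_selmerStructure_duality K)
    (hPT2 : ∀ (K : Type) [Field K] [NumberField K], poitouTate_sha_tateDual K)
    (hH : hsieh2014_exists_anticyclotomicPAdicLFunction)
    (hF : LiuZhangZhang2018.thm151_thm153_modularCurve_heegnerVector) (hMaz : mazur_not_dvd_maninConstant_of_odd)
    (hD : KellerYin2024.thmD_imcMult_exists_isBDPLFunction_isTorsion_charIdeal_eq_OPEN)
    (W : WeierstrassCurve ℚ) [W.IsElliptic] [W.IsGloballyMinimal] (p : ℕ) [Fact p.Prime] (hc : X2.CellB W p)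
    (hK : ∃ (K : Type) (_ : Field K) (_ : NumberField K), IsImaginaryQuadratic K ∧
      SatisfiesHeegnerHypothesis (W.conductorNorm ℤ) K ∧ SatisfiesHeegnerHypothesis p K ∧
      Odd (NumberField.discr K) ∧ NumberField.discr K < -4 ∧
      (W.quadraticTwist (NumberField.discr K : ℚ)).analyticRank = 1 ∧
      ∀ (Wd : WeierstrassCurve ℚ) [Wd.IsElliptic] [Wd.IsGloballyMinimal],
        (∃ C : VariableChange ℚ, C • Wd = W.quadraticTwist (NumberField.discr K : ℚ)) →
        MissingUpperBoundAt Wd p) :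
    BSDp W p := by
  obtain ⟨K, _, _, hK, hHN, hHp, hodd, hlt, hr1, hall⟩ := hK
  have hd0 : (NumberField.discr K : ℚ) ≠ 0 := by exact_mod_cast (IsImaginaryQuadratic.discr_neg hK).ne
  obtain ⟨Wd, _, _, C, hC⟩ := exists_isGloballyMinimal_smul_eq_quadraticTwist W hd0
  exact bsdp_of_cellB_of_upper_partnerAt hP hPT hPT2 hH hF hMaz hD W p hc K hK hHN hHp hodd hlt hr1 Wd ⟨C, hC⟩
    (hall Wd ⟨C, hC⟩)

/-- **The crux BY NAME from «reachable unit end» ∨ «(∃-PARTNER) OFF the reachable unit ends»** — the composition shape a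
skeleton gets by testing, at each X2b pair, whether a Ш-unit end is reachable at distance `≥ 0` along `TwoStepAt p`
(then §2, road (e) along chains; distance `0` = Wuthrich Prop. 21 at the pair itself) and otherwise invoking the
(∃-PARTNER) clause (then `mazurMainConjectureAt_of_cellB_of_upperPartnerClause`). The hypothesis `hoff` is exactly what a
stub «(∃-PARTNER) at X2b pairs with NO reachable unit end» (plus whatever further exclusions the skeleton derives, e.g.
the closed sub-row) supplies. CONDITIONAL: `EisensteinPrimes.MazurMCOnCellB` is concluded BY NAME only under the named
facts and `hoff` (audit: `proof.conditional`, credits nothing); no summit statement / MC / BSD is proved.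
[claim: KellerYin2024, status: under-review] [cite: Wuthrich2014, Thm. 16 (p. 397) and Prop. 21 (p. 400)]
[cite: KellerYin2024, Thm. D = Thm. 5.1.3] [cite: SilvermanAEC2009, VIII.8 Cor. 8.3] -/
theorem mazurMCOnCellB_of_namedFacts_of_upperPartnerOffReachableUnitEnd (hP : EisensteinPrimes.PublishedInputs)
    (hW21 : sha_dvd_analyticSha)
    (hPT : ∀ (K : Type) [Field K] [NumberField K], poitouTate_selmerStructure_duality K)
    (hPT2 : ∀ (K : Type) [Field K] [NumberField K], poitouTate_sha_tateDual K)
    (hH : hsieh2014_exists_anticyclotomicPAdicLFunction)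
    (hF : LiuZhangZhang2018.thm151_thm153_modularCurve_heegnerVector) (hMaz : mazur_not_dvd_maninConstant_of_odd)
    (hD : KellerYin2024.thmD_imcMult_exists_isBDPLFunction_isTorsion_charIdeal_eq_OPEN)
    (hoff : ∀ (W : WeierstrassCurve ℚ) [W.IsElliptic] [W.IsGloballyMinimal] (p : ℕ) [Fact p.Prime],
      X2.CellB W p →
      ¬ (∃ (W'' : WeierstrassCurve ℚ) (_ : W''.IsElliptic) (_ : W''.IsGloballyMinimal),
          Relation.ReflTransGen (TwoStepAt p) W W'' ∧ ∃ q : ℚ, shaAn W'' = (q : ℂ) ∧ padicValRat p q = 0) →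
      ∃ (K : Type) (_ : Field K) (_ : NumberField K), IsImaginaryQuadratic K ∧
        SatisfiesHeegnerHypothesis (W.conductorNorm ℤ) K ∧ SatisfiesHeegnerHypothesis p K ∧
        Odd (NumberField.discr K) ∧ NumberField.discr K < -4 ∧
        (W.quadraticTwist (NumberField.discr K : ℚ)).analyticRank = 1 ∧
        ∀ (Wd : WeierstrassCurve ℚ) [Wd.IsElliptic] [Wd.IsGloballyMinimal],
          (∃ C : VariableChange ℚ, C • Wd = W.quadraticTwist (NumberField.discr K : ℚ)) →
          MissingUpperBoundAt Wd p) :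
    EisensteinPrimes.MazurMCOnCellB := by
  intro W _ _ p _ hc
  by_cases he : ∃ (W'' : WeierstrassCurve ℚ) (_ : W''.IsElliptic) (_ : W''.IsGloballyMinimal),
      Relation.ReflTransGen (TwoStepAt p) W W'' ∧ ∃ q : ℚ, shaAn W'' = (q : ℂ) ∧ padicValRat p q = 0
  · exact mazurMainConjectureAt_of_cellB_of_exists_reflTransGen_shaAn_unit hP hW21 hPT hPT2 hH hF hMaz hD W p hc he
  · exact mazurMainConjectureAt_of_cellB_of_upperPartnerClause hP hPT hPT2 hH hF hMaz hD W p hc (hoff W p hc he)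

end Summit.BirchSwinnertonDyer.BirchSwinnertonDyer.Theorems.EisensteinPrimesMazurMCOnCellBTwistbackTwoStepChainByName

end
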